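import Mathlib
import Summits.Ventures.FusionMHD.Models.CerfonFreidbergNstxLikeQHalfSurface
import Summits.Ventures.FusionMHD.Models.CerfonFreidbergIterLikeQHalfLevel
import Summits.Ventures.FusionMHD.Models.FluxSurfacePolarRayLevelLoop
import HarnessLib

/-!
# Ventures/FusionMHD — Models/CerfonFreidbergNstxLikeQHalfLevel.lean: the surface `ψ_N = 1/2` of THE Cerfon–Freidberg NSTX-like
# flux IS A `LevelLoop` — «F2.CF-Q-INTERIOR-NSTX»'s certificates (model-5 g8), re-read with LEVEL MARGINS, discharge every hypothesis of the Leibniz rule across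
# surfaces; hence `q(u)`, `V′(u)` of EVERY nearby level are polar integrals and `dq/du`, `dV′/du` EXIST at `u₀` as explicit θ-integrals

HONEST FRAMING (LADDER-GRIDFUSION three columns; CF rung, F2 item R2; NSTX-like TWIN of `Models/CerfonFreidbergIterLikeQHalfLevel.lean` —
the ITER-like text with the NSTX-like objects (model-5 g8's chain `…NstxLikeQHalf{Defs,…,Data,Facts,Surface}.lean`); LOW, no count).
* CERTIFIED (kernel; this file + imports, axioms standard): for THE flux `CFNstxLike.U = cfSolution 0 coeff` of the CF NSTX-like instance and the
  level `u₀ = CFNstxLike.U(X_a,0)/2`: (§2) every one of the NSTX-like chain's 32 `θ`-panels on `[0, π]` — kernel facts `(dP k).ok`, `(bP k).ok` ALREADY IN THE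
  TREE (`…QHalfData`), plus the rational side conditions `LinkData.check` and ONE new rational check `levelCheck` per panel (`decide`,
  milliseconds) — is a `PolarRay.LevelPanel CFNstxLike.U X_a 0 (aθ k) (aθ (k+1)) s_A s_max (u₀ − δ) (u₀ + δ) Dfield` with the COMMON level margin
  `δ = 10⁻¹²` (core: `CFNstxLike.U ≤ u₀ − κ_k`, `κ_k = 10⁻⁴ ≥ δ`; outer: `CFNstxLike.U(ray(m + r)) ≥ u₀ + r(d⁻ − Mr) − η ≥ u₀ + δ`, then monotone to `s_max`);
  (§3) with the mirror `CFNstxLike.U(X, −Y) = CFNstxLike.U(X, Y)` (`UN_neg`) the 64 panels `[πk/32, π(k+1)/32]` form a `PolarRay.LevelLoop` over `[0, 2π]`;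
  (§4) CONSEQUENCES BY NAME from model-7's `FluxSurfacePolarRayLevelLoop`: for every level `u` with `|u − u₀| < 10⁻¹²` the glued loop
  `θ ↦ (X_a + ρ_u cos θ, ρ_u sin θ)` is a continuous star-shaped curve on which Freidberg's `q` (6.35) and Jardin's `V′` (5.29) ARE the
  polar integrals `(F/2π)∫₀^{2π} polarIntegrand` / `2π∫₀^{2π} volKernel`; and **`u ↦ q(u)`, `u ↦ V′(u)` are DIFFERENTIABLE at `u₀`** with
  derivatives `(F/2π)∫₀^{2π} polarKernelDs X_a Dfield F2field θ (ρ θ)/Dfield θ (ρ θ) dθ` and `2π∫₀^{2π} volKernelDs …/Dfield dθ` —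
  Jardin (8.134)'s shear input `Φ″ = 2π dq/dΨ` and `V″` on this IMPLICIT surface exist and are ONE explicit θ-integral each.
* VALIDATED: nothing used; no value of `dq/du` or `V″` claimed.  MODELLED: analytic CF family; MODEL surfaces — never a device or stability.
Typer/prover: gridfusion-model-7 (g6; port of g5's ITER-like file), 2026-08-27.  Citations: Freidberg 2014 (6.35) [Freidberg2014]; Jardin 2010 (5.29), (8.134) [Jardin2010].
-/

noncomputable section

open Set MeasureTheory intervalIntegral Filter Topology
open Literature.Analysis.ODE Literature.Analysis.ODE.FExpr
open Literature.Analysis.ValidatedNumerics Literature.Analysis.ValidatedNumerics.PolyMP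
open Literature.Analysis.ValidatedNumerics.NumericsMP Literature.Analysis.ValidatedNumerics.ExpPoly
open Literature.MathematicalPhysics.MHD Literature.MathematicalPhysics.MHD.CerfonFreidberg Literature.MathematicalPhysics.MHD.GradShafranov
open Summit.Ventures.FusionMHD.Models.PolarRay
open Summit.Ventures.FusionMHD.Models.CFIterLike.PolarPanel (gExpr dExpr cOf)
open Summit.Ventures.FusionMHD.Models.CFIterLike.QHalf (gExpr_dom ddExpr_eval_eq)

namespace Summit.Ventures.FusionMHD.Models.CFNstxLike.QHalf

/-! ## §1 The second ray derivative field `F2field = ∂_s D_r` and its joint continuity on boxes -/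
/-- The SECOND RAY DERIVATIVE field `(θ, s) ↦ ∂_s D_r = cos²θ·U_XX + 2 sin θ cos θ·U_XY + sin²θ·U_YY` at the ray point
(`…QHalfRay.F2c` with the instance data). -/
def F2field (θ s : ℝ) : ℝ := CFIterLike.QHalf.F2c coeff CFNstxLike.Xa s θ

/-- `HasDerivAt (Dfield θ) (F2field θ s) s` for `X = X_a + s cos θ > 0` (`…QHalfRay.hasDerivAt_Drc`). -/
theorem hasDerivAt_Dfield {θ s : ℝ} (hX : 0 < CFNstxLike.Xa + s * Real.cos θ) : HasDerivAt (Dfield θ) (F2field θ s) s :=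
  hasDerivAt_Drc hX

/-- **Joint continuity of `F2field`** on `[a, b] × [s₁, s₂]` with `0 ≤ s₁`, `s₂ < 1` (the code list's second `s`-partial is `C^∞` on
its domain `X > 0`). -/
theorem continuousOn_F2field_box {a b s₁ s₂ : ℝ} (h₁ : 0 ≤ s₁) (h₂ : s₂ < 1) :
    ContinuousOn (fun p : ℝ × ℝ => F2field p.1 p.2) (Icc a b ×ˢ Icc s₁ s₂) := by
  have hg : ContinuousOn (fun p : ℝ × ℝ => (dExpr.pderiv 10).eval (pt p.1 p.2)) (Icc a b ×ˢ Icc s₁ s₂) := by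
    refine (contDiffOn_eval (dExpr.pderiv 10)).continuousOn.comp continuous_pt.continuousOn ?_
    intro p hp
    obtain ⟨e7, e9, e10⟩ := pt_coords p.1 p.2
    show (dExpr.pderiv 10).dom (pt p.1 p.2)
    exact dom_pderiv 10 dExpr (dom_pderiv 10 gExpr (gExpr_dom (by rw [e7, e9, e10]; exact X_pos_of_box h₁ h₂ hp.2)))
  refine hg.congr fun p hp => ?_
  obtain ⟨e7, e9, e10⟩ := pt_coords p.1 p.2
  have hX : pt p.1 p.2 7 + pt p.1 p.2 10 * Real.cos (pt p.1 p.2 9) ≠ 0 := by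
    rw [e7, e9, e10]; exact (X_pos_of_box h₁ h₂ hp.2).ne'
  show F2field p.1 p.2 = (dExpr.pderiv 10).eval (pt p.1 p.2)
  rw [ddExpr_eval_eq _ hX, cOf_pt, e7, e9, e10]
  rfl

/-! ## §2 One panel of the NSTX-like chain is a `LevelPanel` with level margins `δ = 10⁻¹²` -/
/-- The common level margin of the NSTX-like chain: `δ = 10⁻¹²` (its tubes are tighter than the ITER-like ones: the minimal outer margin
`r(d⁻ − Mr) − η` is `≈ 6.1·10⁻¹²`, panel 29). -/
def δQ : ℚ := 1 / 1000000000000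
/-- THE ONE NEW RATIONAL CHECK per panel (NSTX-like data): `δ ≤ κ` (core margin) and `δ + η ≤ r·(d⁻ − M·r)` (outer margin at the tube top). -/
def levelCheck (ℓ : LinkData) (d : PanelCert) (b : BoxData) : Bool :=
  decide (δQ ≤ b.kap) && decide (δQ + (d.eta : ℚ) / CFIterLike.QHalf.tmS ≤ ℓ.r * ((d.dlo : ℚ) / CFIterLike.QHalf.tmS - b.M * ℓ.r))
section panel
variable {d : PanelCert} {b : BoxData} {ℓ : LinkData}

/-- **ONE PANEL IS A `LevelPanel`.**  If panel `j`'s certificate `d`, box data `b` and link constants `ℓ` pass `d.ok`, `b.ok`, `ℓ.check d b`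
and `levelCheck ℓ d b`, then on `Θ_j × [s_A, s_max]` the panel hypotheses with level margins hold for the levels `(u₀ − δ, u₀ + δ)`:
joint continuity, `HasDerivAt (CFNstxLike.U∘ray_θ) (Dfield θ s) s`, `Dfield ≥ λ > 0` on the strip, core `CFNstxLike.U ≤ u₀ − δ`, outer `CFNstxLike.U(ray s_max) ≥ u₀ + δ`. -/
theorem levelPanel_of_check (hd : d.ok = true) (hb : b.ok = true) (hℓ : ℓ.check d b = true) (hlev : levelCheck ℓ d b = true) :
    LevelPanel CFNstxLike.U CFNstxLike.Xa 0 (Real.pi * ((panelLeft CFIterLike.QHalf.hw d.j : ℚ) : ℝ)) (Real.pi * ((panelLeft CFIterLike.QHalf.hw (d.j + 1) : ℚ) : ℝ))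
      ((b.sA : ℚ) : ℝ) ((b.smax : ℚ) : ℝ) (u₀ - ((δQ : ℚ) : ℝ)) (u₀ + ((δQ : ℚ) : ℝ)) Dfield := by
  set a : ℝ := Real.pi * ((panelLeft CFIterLike.QHalf.hw d.j : ℚ) : ℝ) with ha_def
  set a' : ℝ := Real.pi * ((panelLeft CFIterLike.QHalf.hw (d.j + 1) : ℚ) : ℝ) with ha'_def
  -- unpack the rational side conditions
  simp only [LinkData.check, Bool.and_eq_true, decide_eq_true_eq] at hℓ
  obtain ⟨⟨⟨⟨⟨⟨⟨⟨⟨⟨⟨⟨⟨⟨⟨⟨⟨⟨⟨⟨⟨⟨⟨⟨⟨cbj, cℓj⟩, cthlo⟩, cthhi⟩, csA0⟩, csA⟩, csmax⟩, cr0⟩, crμ⟩, clam0⟩, clam1⟩, clam2⟩, cdtop1⟩,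
    cdtop2⟩, cM0⟩, cmlo0⟩, cdlo0⟩, cplo0⟩, ckap⟩, ceps⟩, ceps1⟩, crX⟩, crD⟩, ckplus⟩, cLo⟩, cHi⟩ := hℓ
  simp only [levelCheck, Bool.and_eq_true, decide_eq_true_eq] at hlev
  obtain ⟨cδkap, cδout⟩ := hlev
  -- the kernel facts
  obtain ⟨-, hres, hm, hD⟩ := sound_of_ok hd
  obtain ⟨hB1, hB2⟩ := BoxData.sound hb
  have hbok := hb
  simp only [BoxData.ok, Bool.and_eq_true, decide_eq_true_eq] at hbok
  obtain ⟨⟨⟨⟨⟨⟨⟨⟨⟨-, -⟩, -⟩, -⟩, -⟩, -⟩, hsAsmax⟩, hsmax1⟩, -⟩, -⟩ := hbok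
  -- real versions of the constants
  have hS : (0 : ℝ) < ((CFIterLike.QHalf.tmS : ℕ) : ℝ) := by exact_mod_cast CFIterLike.QHalf.tmS_pos
  have hpi := Real.pi_pos
  have hpiLo : ((CFIterLike.QHalf.piLoQ : ℚ) : ℝ) < Real.pi := by have := Real.pi_gt_d20; norm_num [CFIterLike.QHalf.piLoQ] at this ⊢; exact this
  have hpiHi : Real.pi < ((CFIterLike.QHalf.piHiQ : ℚ) : ℝ) := by have := Real.pi_lt_d20; norm_num [CFIterLike.QHalf.piHiQ] at this ⊢; exact this
  have hpl0 : (0 : ℚ) ≤ panelLeft CFIterLike.QHalf.hw d.j := by unfold panelLeft CFIterLike.QHalf.hw; positivity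
  have haa' : a ≤ a' := by
    apply mul_le_mul_of_nonneg_left _ hpi.le
    exact_mod_cast (show panelLeft CFIterLike.QHalf.hw d.j ≤ panelLeft CFIterLike.QHalf.hw (d.j + 1) by unfold panelLeft CFIterLike.QHalf.hw; push_cast; nlinarith)
  have hθbox : ∀ θ ∈ Icc a a', θ ∈ Icc ((b.thlo : ℚ) : ℝ) ((b.thhi : ℚ) : ℝ) := by
    intro θ hθ
    have h1 : ((b.thlo : ℚ) : ℝ) ≤ a := by
      have : ((b.thlo : ℚ) : ℝ) ≤ ((CFIterLike.QHalf.piLoQ : ℚ) : ℝ) * ((panelLeft CFIterLike.QHalf.hw d.j : ℚ) : ℝ) := by exact_mod_cast cthlo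
      have h2 : ((CFIterLike.QHalf.piLoQ : ℚ) : ℝ) * ((panelLeft CFIterLike.QHalf.hw d.j : ℚ) : ℝ) ≤ a :=
        mul_le_mul_of_nonneg_right hpiLo.le (by exact_mod_cast hpl0)
      linarith
    have h2 : a' ≤ ((b.thhi : ℚ) : ℝ) := by
      have : ((CFIterLike.QHalf.piHiQ : ℚ) : ℝ) * ((panelLeft CFIterLike.QHalf.hw (d.j + 1) : ℚ) : ℝ) ≤ ((b.thhi : ℚ) : ℝ) := by exact_mod_cast cthhi
      have hpl1 : (0 : ℝ) ≤ ((panelLeft CFIterLike.QHalf.hw (d.j + 1) : ℚ) : ℝ) := by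
        exact_mod_cast (show (0 : ℚ) ≤ panelLeft CFIterLike.QHalf.hw (d.j + 1) by unfold panelLeft CFIterLike.QHalf.hw; positivity)
      have h3 : a' ≤ ((CFIterLike.QHalf.piHiQ : ℚ) : ℝ) * ((panelLeft CFIterLike.QHalf.hw (d.j + 1) : ℚ) : ℝ) := mul_le_mul_of_nonneg_right hpiHi.le hpl1
      linarith
    exact ⟨h1.trans hθ.1, hθ.2.trans h2⟩
  have hθt : ∀ θ ∈ Icc a a', |θ / Real.pi - ((CFIterLike.QHalf.ctr d.j : ℚ) : ℝ)| ≤ ((CFIterLike.QHalf.hw : ℚ) : ℝ) := by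
    intro θ hθ
    have e1 : ((CFIterLike.QHalf.ctr d.j : ℚ) : ℝ) = ((panelLeft CFIterLike.QHalf.hw d.j : ℚ) : ℝ) + ((CFIterLike.QHalf.hw : ℚ) : ℝ) := by
      simp only [CFIterLike.QHalf.ctr, panelLeft]; push_cast; ring
    have e2 : ((panelLeft CFIterLike.QHalf.hw (d.j + 1) : ℚ) : ℝ) = ((panelLeft CFIterLike.QHalf.hw d.j : ℚ) : ℝ) + 2 * ((CFIterLike.QHalf.hw : ℚ) : ℝ) := by
      simp only [panelLeft]; push_cast; ring
    have ht1 : ((panelLeft CFIterLike.QHalf.hw d.j : ℚ) : ℝ) ≤ θ / Real.pi := by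
      rw [le_div_iff₀ hpi]; linarith [hθ.1, mul_comm Real.pi (((panelLeft CFIterLike.QHalf.hw d.j : ℚ) : ℝ))]
    have ht2 : θ / Real.pi ≤ ((panelLeft CFIterLike.QHalf.hw (d.j + 1) : ℚ) : ℝ) := by
      rw [div_le_iff₀ hpi]; linarith [hθ.2, mul_comm Real.pi (((panelLeft CFIterLike.QHalf.hw (d.j + 1) : ℚ) : ℝ))]
    rw [e1, abs_le]; constructor <;> linarith
  -- per-θ facts from the panel certificate (t = θ/π = CFIterLike.QHalf.ctr j + u)
  have hθm : ∀ θ ∈ Icc a a', ((d.mlo : ℝ) / ((CFIterLike.QHalf.tmS : ℕ) : ℝ)) ≤ mθ θ ∧ mθ θ ≤ ((d.mhi : ℝ) / ((CFIterLike.QHalf.tmS : ℕ) : ℝ)) := by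
    intro θ hθ
    have h := hm (θ / Real.pi - ((CFIterLike.QHalf.ctr d.j : ℚ) : ℝ)) (hθt θ hθ)
    simp only [add_sub_cancel] at h
    exact h
  have hθres : ∀ θ ∈ Icc a a', |rayProfile CFNstxLike.U CFNstxLike.Xa 0 θ (mθ θ) - u₀| ≤ ((d.eta : ℝ) / ((CFIterLike.QHalf.tmS : ℕ) : ℝ)) := by
    intro θ hθ
    have h := hres (θ / Real.pi - ((CFIterLike.QHalf.ctr d.j : ℚ) : ℝ)) (hθt θ hθ)
    simp only [add_sub_cancel] at h
    have e : Real.pi * (θ / Real.pi) = θ := mul_div_cancel₀ θ hpi.ne'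
    unfold resid at h
    rw [e] at h
    unfold rayProfile u₀ mθ
    rw [zero_add]
    exact h
  have hθD : ∀ θ ∈ Icc a a', ((d.dlo : ℝ) / ((CFIterLike.QHalf.tmS : ℕ) : ℝ)) ≤ Dfield θ (mθ θ) ∧ Dfield θ (mθ θ) ≤ ((d.dhi : ℝ) / ((CFIterLike.QHalf.tmS : ℕ) : ℝ)) := by
    intro θ hθ
    have h := hD (θ / Real.pi - ((CFIterLike.QHalf.ctr d.j : ℚ) : ℝ)) (hθt θ hθ)
    simp only [add_sub_cancel] at h
    have e : Real.pi * (θ / Real.pi) = θ := mul_div_cancel₀ θ hpi.ne'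
    unfold DrA at h
    rw [e] at h
    exact h
  -- constants in ℝ
  have hsA0 : 0 < ((b.sA : ℚ) : ℝ) := by exact_mod_cast csA0
  have hsAr : ((b.sA : ℚ) : ℝ) + ((ℓ.r : ℚ) : ℝ) ≤ ((d.mlo : ℝ) / ((CFIterLike.QHalf.tmS : ℕ) : ℝ)) := by
    have := (show ((b.sA + ℓ.r : ℚ) : ℝ) ≤ (((d.mlo : ℚ) / CFIterLike.QHalf.tmS : ℚ) : ℝ) by exact_mod_cast csA); push_cast at this; exact this
  have hmhir : ((d.mhi : ℝ) / ((CFIterLike.QHalf.tmS : ℕ) : ℝ)) + ((ℓ.r : ℚ) : ℝ) ≤ ((b.smax : ℚ) : ℝ) := by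
    have := (show ((((d.mhi : ℚ) / CFIterLike.QHalf.tmS + ℓ.r : ℚ)) : ℝ) ≤ ((b.smax : ℚ) : ℝ) by exact_mod_cast csmax); push_cast at this; exact this
  have hr0 : 0 < ((ℓ.r : ℚ) : ℝ) := by exact_mod_cast cr0
  have hlam0 : 0 < ((ℓ.lam : ℚ) : ℝ) := by exact_mod_cast clam0
  have hlam1 : ((ℓ.lam : ℚ) : ℝ) + ((b.M : ℚ) : ℝ) * (((d.mhi : ℝ) / ((CFIterLike.QHalf.tmS : ℕ) : ℝ)) - ((b.sA : ℚ) : ℝ)) ≤ ((d.dlo : ℝ) / ((CFIterLike.QHalf.tmS : ℕ) : ℝ)) := by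
    have := (show ((ℓ.lam + b.M * ((d.mhi : ℚ) / CFIterLike.QHalf.tmS - b.sA) : ℚ) : ℝ) ≤ ((((d.dlo : ℚ) / CFIterLike.QHalf.tmS : ℚ)) : ℝ) by exact_mod_cast clam1)
    push_cast at this; exact this
  have hlam2 : ((ℓ.lam : ℚ) : ℝ) + ((b.M : ℚ) : ℝ) * (((b.smax : ℚ) : ℝ) - ((d.mlo : ℝ) / ((CFIterLike.QHalf.tmS : ℕ) : ℝ))) ≤ ((d.dlo : ℝ) / ((CFIterLike.QHalf.tmS : ℕ) : ℝ)) := by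
    have := (show ((ℓ.lam + b.M * (b.smax - (d.mlo : ℚ) / CFIterLike.QHalf.tmS) : ℚ) : ℝ) ≤ ((((d.dlo : ℚ) / CFIterLike.QHalf.tmS : ℚ)) : ℝ) by exact_mod_cast clam2)
    push_cast at this; exact this
  have hM0 : 0 ≤ ((b.M : ℚ) : ℝ) := by exact_mod_cast cM0
  have hsmax1 : ((b.smax : ℚ) : ℝ) < 1 := by exact_mod_cast hsmax1
  have hsAsmax' : ((b.sA : ℚ) : ℝ) ≤ ((b.smax : ℚ) : ℝ) := by exact_mod_cast hsAsmax
  have hδkap : ((δQ : ℚ) : ℝ) ≤ ((b.kap : ℚ) : ℝ) := by exact_mod_cast cδkap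
  have hδout : ((δQ : ℚ) : ℝ) + ((d.eta : ℝ) / ((CFIterLike.QHalf.tmS : ℕ) : ℝ))
      ≤ ((ℓ.r : ℚ) : ℝ) * (((d.dlo : ℝ) / ((CFIterLike.QHalf.tmS : ℕ) : ℝ)) - ((b.M : ℚ) : ℝ) * ((ℓ.r : ℚ) : ℝ)) := by
    have := (show ((δQ + (d.eta : ℚ) / CFIterLike.QHalf.tmS : ℚ) : ℝ) ≤ ((ℓ.r * ((d.dlo : ℚ) / CFIterLike.QHalf.tmS - b.M * ℓ.r) : ℚ) : ℝ) by exact_mod_cast cδout)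
    push_cast at this; exact this
  -- derivative facts on [0, s_max] ⊂ [0, 1)
  have hderF : ∀ θ s, 0 ≤ s → s ≤ ((b.smax : ℚ) : ℝ) → HasDerivAt (rayProfile CFNstxLike.U CFNstxLike.Xa 0 θ) (Dfield θ s) s := by
    intro θ s h0 h1; exact hasDerivAt_rayProfile (X_pos h0 (h1.trans_lt hsmax1))
  have hderD : ∀ θ s, 0 ≤ s → s ≤ ((b.smax : ℚ) : ℝ) → HasDerivAt (fun x => Dfield θ x) (CFIterLike.QHalf.F2c coeff CFNstxLike.Xa s θ) s := by
    intro θ s h0 h1; exact hasDerivAt_Drc (X_pos h0 (h1.trans_lt hsmax1))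
  -- Lipschitz of D on the strip
  have hLip : ∀ θ ∈ Icc a a', ∀ s ∈ Icc ((b.sA : ℚ) : ℝ) ((b.smax : ℚ) : ℝ), ∀ s' ∈ Icc ((b.sA : ℚ) : ℝ) ((b.smax : ℚ) : ℝ),
      |Dfield θ s - Dfield θ s'| ≤ ((b.M : ℚ) : ℝ) * |s - s'| := by
    intro θ hθ s hs s' hs'
    have h := Convex.norm_image_sub_le_of_norm_hasDerivWithin_le (f := fun x => Dfield θ x) (f' := fun x => CFIterLike.QHalf.F2c coeff CFNstxLike.Xa x θ)
      (s := Icc ((b.sA : ℚ) : ℝ) ((b.smax : ℚ) : ℝ)) (fun x hx => (hderD θ x (hsA0.le.trans hx.1) hx.2).hasDerivWithinAt)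
      (fun x hx => by rw [Real.norm_eq_abs]; exact hB2 θ (hθbox θ hθ) x hx) (convex_Icc _ _) hs' hs
    rw [Real.norm_eq_abs, Real.norm_eq_abs] at h
    exact h
  have hmstrip : ∀ θ ∈ Icc a a', mθ θ ∈ Icc ((b.sA : ℚ) : ℝ) ((b.smax : ℚ) : ℝ) := by
    intro θ hθ; obtain ⟨h1, h2⟩ := hθm θ hθ; exact ⟨by linarith, by linarith⟩
  -- D ≥ λ on the strip (certified value at m and the Lipschitz bound)
  have hDstrip : ∀ θ ∈ Icc a a', ∀ s ∈ Icc ((b.sA : ℚ) : ℝ) ((b.smax : ℚ) : ℝ), ((ℓ.lam : ℚ) : ℝ) ≤ Dfield θ s := by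
    intro θ hθ s hs
    have hL := hLip θ hθ s hs (mθ θ) (hmstrip θ hθ)
    obtain ⟨hm1, hm2⟩ := hθm θ hθ
    obtain ⟨hD1, -⟩ := hθD θ hθ
    have hab := abs_le.1 hL
    rcases le_total s (mθ θ) with hle | hle
    · have habs : |s - mθ θ| = mθ θ - s := by rw [abs_of_nonpos (by linarith)]; ring
      rw [habs] at hab
      have : ((b.M : ℚ) : ℝ) * (mθ θ - s) ≤ ((b.M : ℚ) : ℝ) * (((d.mhi : ℝ) / ((CFIterLike.QHalf.tmS : ℕ) : ℝ)) - ((b.sA : ℚ) : ℝ)) :=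
        mul_le_mul_of_nonneg_left (by linarith [hs.1]) hM0
      linarith [hab.1, hab.2]
    · have habs : |s - mθ θ| = s - mθ θ := abs_of_nonneg (by linarith)
      rw [habs] at hab
      have : ((b.M : ℚ) : ℝ) * (s - mθ θ) ≤ ((b.M : ℚ) : ℝ) * (((b.smax : ℚ) : ℝ) - ((d.mlo : ℝ) / ((CFIterLike.QHalf.tmS : ℕ) : ℝ))) :=
        mul_le_mul_of_nonneg_left (by linarith [hs.2]) hM0
      linarith [hab.1, hab.2]
  -- strict monotonicity of the ray profile on the strip
  have hcontF : ∀ θ, ContinuousOn (rayProfile CFNstxLike.U CFNstxLike.Xa 0 θ) (Icc ((b.sA : ℚ) : ℝ) ((b.smax : ℚ) : ℝ)) := by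
    intro θ s hs; exact (hderF θ s (hsA0.le.trans hs.1) hs.2).continuousAt.continuousWithinAt
  have hmono : ∀ θ ∈ Icc a a', StrictMonoOn (rayProfile CFNstxLike.U CFNstxLike.Xa 0 θ) (Icc ((b.sA : ℚ) : ℝ) ((b.smax : ℚ) : ℝ)) := by
    intro θ hθ
    apply strictMonoOn_rayProfile_of_deriv_pos (hcontF θ)
    intro s hs
    rw [(hderF θ s (hsA0.le.trans hs.1.le) hs.2.le).deriv]
    exact hlam0.trans_le (hDstrip θ hθ s ⟨hs.1.le, hs.2.le⟩)
  -- OUTER MARGIN: CFNstxLike.U(ray (m + r)) ≥ u₀ + δ (mean value with D ≥ d⁻ − M r on the tube), then monotone up to s_max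
  have hout : ∀ θ ∈ Icc a a', u₀ + ((δQ : ℚ) : ℝ) ≤ rayProfile CFNstxLike.U CFNstxLike.Xa 0 θ ((b.smax : ℚ) : ℝ) := by
    intro θ hθ
    obtain ⟨hm1, hm2⟩ := hθm θ hθ
    set μ : ℝ := ((d.dlo : ℝ) / ((CFIterLike.QHalf.tmS : ℕ) : ℝ)) - ((b.M : ℚ) : ℝ) * ((ℓ.r : ℚ) : ℝ) with hμ
    have htube : ∀ s ∈ Icc (mθ θ) (mθ θ + ((ℓ.r : ℚ) : ℝ)), s ∈ Icc ((b.sA : ℚ) : ℝ) ((b.smax : ℚ) : ℝ) :=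
      fun s hs => ⟨by linarith [hs.1], by linarith [hs.2]⟩
    have hslope : ∀ s ∈ Icc (mθ θ) (mθ θ + ((ℓ.r : ℚ) : ℝ)), μ ≤ Dfield θ s := by
      intro s hs
      have hL := hLip θ hθ s (htube s hs) (mθ θ) (hmstrip θ hθ)
      have hsm : |s - mθ θ| ≤ ((ℓ.r : ℚ) : ℝ) := abs_le.2 ⟨by linarith [hs.1], by linarith [hs.2]⟩
      have h1 := abs_le.1 (le_trans hL (mul_le_mul_of_nonneg_left hsm hM0))
      rw [hμ]; linarith [(hθD θ hθ).1]
    -- mean value inequality on [m, m + r]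
    have hcont : ContinuousOn (rayProfile CFNstxLike.U CFNstxLike.Xa 0 θ) (Icc (mθ θ) (mθ θ + ((ℓ.r : ℚ) : ℝ))) :=
      fun s hs => (hderF θ s (hsA0.le.trans (htube s hs).1) (htube s hs).2).continuousAt.continuousWithinAt
    have hdiff : DifferentiableOn ℝ (rayProfile CFNstxLike.U CFNstxLike.Xa 0 θ) (interior (Icc (mθ θ) (mθ θ + ((ℓ.r : ℚ) : ℝ)))) := by
      rw [interior_Icc]
      exact fun s hs => (hderF θ s (hsA0.le.trans (htube s (Ioo_subset_Icc_self hs)).1)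
        (htube s (Ioo_subset_Icc_self hs)).2).differentiableAt.differentiableWithinAt
    have hge : ∀ s ∈ interior (Icc (mθ θ) (mθ θ + ((ℓ.r : ℚ) : ℝ))), μ ≤ deriv (rayProfile CFNstxLike.U CFNstxLike.Xa 0 θ) s := by
      rw [interior_Icc]; intro s hs
      rw [(hderF θ s (hsA0.le.trans (htube s (Ioo_subset_Icc_self hs)).1) (htube s (Ioo_subset_Icc_self hs)).2).deriv]
      exact hslope s (Ioo_subset_Icc_self hs)
    have hmv := (convex_Icc (mθ θ) (mθ θ + ((ℓ.r : ℚ) : ℝ))).mul_sub_le_image_sub_of_le_deriv hcont hdiff hge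
      (mθ θ) ⟨le_rfl, by linarith⟩ (mθ θ + ((ℓ.r : ℚ) : ℝ)) ⟨by linarith, le_rfl⟩ (by linarith)
    have hres' := (abs_le.1 (hθres θ hθ)).1
    -- CFNstxLike.U(m + r) ≥ u₀ − η + r μ ≥ u₀ + δ
    have htop : u₀ + ((δQ : ℚ) : ℝ) ≤ rayProfile CFNstxLike.U CFNstxLike.Xa 0 θ (mθ θ + ((ℓ.r : ℚ) : ℝ)) := by
      have e : μ * (mθ θ + ((ℓ.r : ℚ) : ℝ) - mθ θ) = ((ℓ.r : ℚ) : ℝ) * μ := by ring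
      rw [e] at hmv
      rw [hμ] at hmv
      linarith
    have hle := (hmono θ hθ).monotoneOn ⟨by linarith, by linarith⟩ ⟨hsAsmax', le_rfl⟩
      (show mθ θ + ((ℓ.r : ℚ) : ℝ) ≤ ((b.smax : ℚ) : ℝ) by linarith)
    exact htop.trans hle
  exact
    { hab := haa'
      hs₁ := hsA0
      hs₁₂ := hsAsmax'
      cont := continuousOn_rayProfile_box hsA0.le hsmax1
      slope := fun θ _ s hs => hderF θ s (hsA0.le.trans hs.1) hs.2
      slopeCont := continuousOn_Drc_box hsA0.le hsmax1
      slopePos := fun θ hθ s hs => hlam0.trans_le (hDstrip θ hθ s hs)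
      inner := fun θ hθ s hs0 hs1 => by
        have h := hB1 θ (hθbox θ hθ) s ⟨hs0.le, hs1⟩
        unfold u₀; linarith
      outer := hout }
end panel

/-! ## §3 The 32 certified panels + their mirror images = a `LevelLoop` over `[0, 2π]` -/
/-- All 32 link checks pass (rational arithmetic; re-decided here once for all `k`). -/
theorem hlP : ∀ k < 32, (CFNstxLike.QHalf.lP k).check (CFNstxLike.QHalf.dP k) (bP k) = true := by decide +kernel

/-- All 32 level checks pass (`δ = 10⁻¹²` against `κ_k = 10⁻⁴` and the outer margins `≥ 6·10⁻¹²`). -/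
theorem hlevP : ∀ k < 32, CFNstxLike.QHalf.levelCheck (CFNstxLike.QHalf.lP k) (dP k) (bP k) = true := by decide +kernel

/-- The panel indices of the data records are `k`. -/
theorem dP_j : ∀ k < 32, (CFNstxLike.QHalf.dP k).j = k := by decide +kernel

/-- The 64-panel partition of `[0, 2π]`: `t_k = πk/32`. -/
def t64 (k : ℕ) : ℝ := Real.pi * ((k : ℝ) / 32)

/-- Lower radial brackets: `s_A` of panel `k` (`k < 32`), mirrored for `k ≥ 32`. -/
def σ₁ (k : ℕ) : ℝ := if k < 32 then (((bP k).sA : ℚ) : ℝ) else (((bP (63 - k)).sA : ℚ) : ℝ)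
/-- Upper radial brackets: `s_max` of panel `k` (`k < 32`), mirrored for `k ≥ 32`. -/
def σ₂ (k : ℕ) : ℝ := if k < 32 then (((bP k).smax : ℚ) : ℝ) else (((bP (63 - k)).smax : ℚ) : ℝ)

/-- `aθ k = t64 k`: the panel ends are `πk/32`. -/
theorem aθ_eq_t64 (k : ℕ) : Real.pi * ((panelLeft CFIterLike.QHalf.hw k : ℚ) : ℝ) = t64 k := by
  unfold t64 panelLeft CFIterLike.QHalf.hw; push_cast; ring

/-- Panels `k < 32`: straight from the certificates. -/
theorem levelPanel_lt {k : ℕ} (hk : k < 32) :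
    LevelPanel CFNstxLike.U CFNstxLike.Xa 0 (t64 k) (t64 (k + 1)) (σ₁ k) (σ₂ k) (u₀ - ((δQ : ℚ) : ℝ)) (u₀ + ((δQ : ℚ) : ℝ)) Dfield := by
  have h := levelPanel_of_check (hdP k hk) (hbP k hk) (hlP k hk) (hlevP k hk)
  rw [dP_j k hk, aθ_eq_t64, aθ_eq_t64] at h
  simp only [σ₁, σ₂, if_pos hk]
  exact_mod_cast h

/-- Panels `32 ≤ k < 64`: mirror images of panels `63 − k` (`CFNstxLike.U(X, −Y) = CFNstxLike.U(X, Y)`, `Dfield(2π − θ, s) = Dfield(θ, s)`). -/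
theorem levelPanel_ge {k : ℕ} (hk : 32 ≤ k) (hk' : k < 64) :
    LevelPanel CFNstxLike.U CFNstxLike.Xa 0 (t64 k) (t64 (k + 1)) (σ₁ k) (σ₂ k) (u₀ - ((δQ : ℚ) : ℝ)) (u₀ + ((δQ : ℚ) : ℝ)) Dfield := by
  have hj : 63 - k < 32 := by omega
  have P := levelPanel_lt hj
  have hsym : ∀ R s : ℝ, CFNstxLike.U R (0 - s) = CFNstxLike.U R (0 + s) := fun R s => by rw [zero_sub, zero_add]; exact UN_neg R s
  have hDm : ∀ θ s : ℝ, Dfield (2 * Real.pi - θ) s = Dfield θ s := fun θ s => (mirror θ).2.1 s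
  have R := P.reflect hsym hDm
  have e1 : 2 * Real.pi - t64 (63 - k + 1) = t64 k := by
    unfold t64; rw [show ((63 - k + 1 : ℕ) : ℝ) = 64 - (k : ℝ) by push_cast [show k ≤ 63 by omega]; ring]; ring
  have e2 : 2 * Real.pi - t64 (63 - k) = t64 (k + 1) := by
    unfold t64; rw [show ((63 - k : ℕ) : ℝ) = 63 - (k : ℝ) by push_cast [show k ≤ 63 by omega]; ring]; push_cast; ring
  rw [e1, e2] at R
  have hk32 : ¬ k < 32 := not_lt.2 hk
  simp only [σ₁, σ₂, if_neg hk32]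
  simp only [σ₁, σ₂, if_pos hj] at R
  exact R

/-- **THE SURFACE `ψ_N = 1/2` IS A `LevelLoop`** (64 panels `[πk/32, π(k+1)/32]`, level margin `10⁻¹²`). -/
theorem levelLoop : LevelLoop CFNstxLike.U CFNstxLike.Xa 0 (u₀ - ((δQ : ℚ) : ℝ)) (u₀ + ((δQ : ℚ) : ℝ)) Dfield 64 t64 σ₁ σ₂ where
  t_zero := by unfold t64; simp
  t_last := by unfold t64; push_cast; ring
  panel := fun k hk => by
    by_cases h : k < 32
    · exact levelPanel_lt h
    · exact levelPanel_ge (not_lt.1 h) hk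

/-! ## §4 Consequences by name: `q(u)`, `V′(u)` of every nearby level; `dq/du`, `dV′/du` exist at `u₀` -/
/-- The Fréchet derivative field of `CFNstxLike.U` at the ray points. -/
def Lray (θ s : ℝ) : ℝ × ℝ →L[ℝ] ℝ := fderiv ℝ (fun q : ℝ × ℝ => CFNstxLike.U q.1 q.2) (rayPoint CFNstxLike.Xa 0 θ s)

/-- The brackets lie in `(0, 1)`: `0 < σ₁ k` and `σ₂ k < 1`. -/
theorem σ_bounds {k : ℕ} (hk : k < 64) : 0 < σ₁ k ∧ σ₂ k < 1 := by
  have key : ∀ j < 32, (0 : ℝ) < (((bP j).sA : ℚ) : ℝ) ∧ (((bP j).smax : ℚ) : ℝ) < 1 := by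
    intro j hj
    have P := levelPanel_lt hj
    have hb := hbP j hj
    simp only [BoxData.ok, Bool.and_eq_true, decide_eq_true_eq] at hb
    obtain ⟨⟨⟨⟨⟨⟨⟨⟨⟨-, -⟩, -⟩, -⟩, -⟩, -⟩, -⟩, hsmax1⟩, -⟩, -⟩ := hb
    have h1 := P.hs₁
    simp only [σ₁, if_pos hj] at h1
    exact ⟨h1, by exact_mod_cast hsmax1⟩
  by_cases h : k < 32
  · simp only [σ₁, σ₂, if_pos h]; exact key k h
  · simp only [σ₁, σ₂, if_neg h]; exact key (63 - k) (by omega)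

/-- `CFNstxLike.U` is Fréchet-differentiable at every ray point of every box, and `R = X_a + s cos θ > 0` there. -/
theorem box_facts : (∀ k < 64, ∀ θ ∈ Icc (t64 k) (t64 (k + 1)), ∀ s ∈ Icc (σ₁ k) (σ₂ k),
      HasFDerivAt (fun q : ℝ × ℝ => CFNstxLike.U q.1 q.2) (Lray θ s) (rayPoint CFNstxLike.Xa 0 θ s))
    ∧ (∀ k < 64, ∀ θ ∈ Icc (t64 k) (t64 (k + 1)), ∀ s ∈ Icc (σ₁ k) (σ₂ k), 0 < CFNstxLike.Xa + s * Real.cos θ) := by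
  have hX : ∀ k < 64, ∀ θ : ℝ, ∀ s ∈ Icc (σ₁ k) (σ₂ k), 0 < CFNstxLike.Xa + s * Real.cos θ := fun k hk θ s hs =>
    X_pos ((σ_bounds hk).1.le.trans hs.1) (hs.2.trans_lt (σ_bounds hk).2)
  refine ⟨fun k hk θ _ s hs => ?_, fun k hk θ _ s hs => hX k hk θ s hs⟩
  have h := hasFDerivAt_cfSolution 0 coeff (X := CFNstxLike.Xa + s * Real.cos θ) (Y := 0 + s * Real.sin θ) (hX k hk θ s hs).ne'
  exact h

/-- `F2field` is the `s`-derivative of `Dfield` on every box, jointly continuous there. -/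
theorem box_facts₂ : (∀ k < 64, ∀ θ ∈ Icc (t64 k) (t64 (k + 1)), ∀ s ∈ Icc (σ₁ k) (σ₂ k), HasDerivAt (Dfield θ) (F2field θ s) s)
    ∧ (∀ k < 64, ContinuousOn (fun p : ℝ × ℝ => F2field p.1 p.2) (Icc (t64 k) (t64 (k + 1)) ×ˢ Icc (σ₁ k) (σ₂ k))) :=
  ⟨fun _ hk _ _ _ hs => hasDerivAt_Dfield (X_pos ((σ_bounds hk).1.le.trans hs.1) (hs.2.trans_lt (σ_bounds hk).2)),
    fun _ hk => continuousOn_F2field_box (σ_bounds hk).1.le (σ_bounds hk).2⟩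

/-- **`q` OF EVERY NEARBY LEVEL IS THE POLAR INTEGRAL**: for `|u − u₀| < 10⁻¹²` and every `F`,
`safetyFactorE F CFNstxLike.U (loop X_a 0 ρ_u) (2π) = (F/2π) ∫₀^{2π} polarIntegrand CFNstxLike.U X_a 0 u Dfield θ dθ` (the headline file had the level `u₀` only). -/
theorem safetyFactorE_eq_near {u : ℝ} (hu : u ∈ Ioo (u₀ - ((δQ : ℚ) : ℝ)) (u₀ + ((δQ : ℚ) : ℝ))) (F : ℝ) :
    safetyFactorE F CFNstxLike.U (loop CFNstxLike.Xa 0 (rayRadius CFNstxLike.U CFNstxLike.Xa 0 u)) (2 * Real.pi)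
      = F / (2 * Real.pi) * ∫ θ in (0 : ℝ)..(2 * Real.pi), polarIntegrand CFNstxLike.U CFNstxLike.Xa 0 u Dfield θ :=
  levelLoop.safetyFactorE_eq F box_facts.1 box_facts.2 hu

/-- **`V′` OF EVERY NEARBY LEVEL IS THE POLAR INTEGRAL**: `volumeDerivE CFNstxLike.U (loop X_a 0 ρ_u) (2π) = 2π ∫₀^{2π} volKernel X_a Dfield θ (ρ_u θ) dθ`. -/
theorem volumeDerivE_eq_near {u : ℝ} (hu : u ∈ Ioo (u₀ - ((δQ : ℚ) : ℝ)) (u₀ + ((δQ : ℚ) : ℝ))) :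
    volumeDerivE CFNstxLike.U (loop CFNstxLike.Xa 0 (rayRadius CFNstxLike.U CFNstxLike.Xa 0 u)) (2 * Real.pi)
      = 2 * Real.pi * ∫ θ in (0 : ℝ)..(2 * Real.pi), volKernel CFNstxLike.Xa Dfield θ (rayRadius CFNstxLike.U CFNstxLike.Xa 0 u θ) :=
  levelLoop.volumeDerivE_eq box_facts.1 box_facts.2 hu

/-- `u₀` is an admissible level. -/
theorem u₀_mem : CFNstxLike.QHalf.u₀ ∈ Ioo (u₀ - ((CFNstxLike.QHalf.δQ : ℚ) : ℝ)) (u₀ + ((δQ : ℚ) : ℝ)) := by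
  have h : (0 : ℝ) < ((δQ : ℚ) : ℝ) := by norm_num [δQ]
  exact ⟨by linarith, by linarith⟩

/-- **`dq/du` EXISTS AT `ψ_N = 1/2` AND IS ONE EXPLICIT θ-INTEGRAL** (Jardin (8.134)'s shear input `Φ″ = 2π dq/dΨ` on this implicit
surface): `HasDerivAt (u ↦ safetyFactorE F CFNstxLike.U (loop X_a 0 ρ_u) (2π)) ((F/2π) ∫₀^{2π} polarKernelDs X_a Dfield F2field θ (ρ θ)/Dfield θ (ρ θ) dθ) u₀`. -/
theorem hasDerivAt_safetyFactorE_half (F : ℝ) :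
    HasDerivAt (fun u => safetyFactorE F CFNstxLike.U (loop CFNstxLike.Xa 0 (rayRadius CFNstxLike.U CFNstxLike.Xa 0 u)) (2 * Real.pi))
      (F / (2 * Real.pi) * ∫ θ in (0 : ℝ)..(2 * Real.pi), polarKernelDs CFNstxLike.Xa Dfield F2field θ (ρ θ) / Dfield θ (ρ θ)) u₀ :=
  levelLoop.hasDerivAt_safetyFactorE F box_facts.1 box_facts.2 box_facts₂.1 box_facts₂.2 u₀_mem

/-- **`dV′/du` EXISTS AT `ψ_N = 1/2` AND IS ONE EXPLICIT θ-INTEGRAL** (Jardin (8.134)'s `V″` on this implicit surface):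
`HasDerivAt (u ↦ volumeDerivE CFNstxLike.U (loop X_a 0 ρ_u) (2π)) (2π ∫₀^{2π} volKernelDs X_a Dfield F2field θ (ρ θ)/Dfield θ (ρ θ) dθ) u₀`. -/
theorem hasDerivAt_volumeDerivE_half :
    HasDerivAt (fun u => volumeDerivE CFNstxLike.U (loop CFNstxLike.Xa 0 (rayRadius CFNstxLike.U CFNstxLike.Xa 0 u)) (2 * Real.pi))
      (2 * Real.pi * ∫ θ in (0 : ℝ)..(2 * Real.pi), volKernelDs CFNstxLike.Xa Dfield F2field θ (ρ θ) / Dfield θ (ρ θ)) u₀ :=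
  levelLoop.hasDerivAt_volumeDerivE box_facts.1 box_facts.2 box_facts₂.1 box_facts₂.2 u₀_mem

end Summit.Ventures.FusionMHD.Models.CFNstxLike.QHalf

end
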